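import Summits.CriticalPhenomena.PercolationContinuityZ3.Theorems.SahiMasterFamilyFCombDisjointMatching
import Summits.CriticalPhenomena.PercolationContinuityZ3.Theorems.SahiMasterFamilyFCombShiftAntipode
import Summits.CriticalPhenomena.PercolationContinuityZ3.Theorems.SahiMasterFamilyFCombFace
import HarnessLib

/-!
# `K(A,B,G) ≥ 0` and `F ≥ 0` for ALL monotone third events

Support file (cell `prim-bnk`, seat bnk-2 gen 21; `--supports stmt-CriticalPhenomena-4575`; complete write-up
`run/shared/lean/prim/prim-l12/PROOF-F-inequality.md`).  No definition, no `sorry`, standard axioms.  Part of the proof of the comb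
inequality `K(A,B,G) ≥ 0` for ALL monotone third events `G`, hence of the master-family inequality
`(1+μG)μ(A∩B∩G) ≥ μG·μ(A∩B) + μ(A∩G)μ(B∩G)` for all increasing `A,B,G` and every product measure (`…FCombAllThirdEvents`).

**THEOREM K (`comb_sum_nonneg`).**  For all monotone `A, B, G : (Fin n → Bool) → Bool` the comb sum
`K(A,B,G) = #{x ∈ ABG} − #{x ∈ AG : x̄ ∈ BG} − #{x ∈ G : x̄ ∈ AB ∖ G}` is `≥ 0`.
Proof: with `W = A∩B`, `L = σG ∖ G`, `Z = σ(dnSeq s (G∩σG))` (full `s`), `N = AG ∩ σ(BG)`:  `K = |W∩G| − |W∩L| − |N|`;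
the disjoint matching (`…DisjointMatching`) composed with `σ` injects `W∩L` into `W∩(G∖Z)` (it is increasing and `W` is an up-set), and
`σ(dnSeq s N) ⊆ W ∩ Z` (shifts are monotone and stay in lower-closed families; `dnSeq s N = dnSeq s (σN)` by `…ShiftAntipode`), so
`K ≥ |W∩Z| − |N| ≥ 0`.
**THEOREM F (`F_nonneg_of_monotone`).**  Consequently (`F_nonneg_of_face_combs_nonneg`, `face_comb_sum_eq`: every tensor-Bernstein
coefficient of `F` is a comb sum of a restricted — again monotone — triple) `(1 + μ_pG)μ_p(ABG) − μ_pG·μ_p(AB) − μ_p(AG)μ_p(BG) ≥ 0`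
for every product measure `p ∈ [0,1]^n` and all monotone `A, B, G`: the master-family `F`-inequality (memos g20/g21: CONJECTURE CP /
R′ / (♠) / (♣)) holds for EVERY increasing third event.  HONEST FRAMING: this closes the `G`-general case left open by
`…FCombFThreshold` / `…FCombFReadOnce`; the `Set (Set ι)` / `secAt` corollaries follow by the bridge `…FCombBridge`. [this work]
-/

namespace Summit.CriticalPhenomena.PercolationContinuityZ3.Theorems

namespace SahiFComb

open Finset

variable {n : ℕ}

/-! ### 10. The comb inequality `K(A,B,G) ≥ 0` for ALL monotone third events -/

/-- Monotone Boolean functions, pointwise form. [folklore] -/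
theorem mono_apply {G : (Fin n → Bool) → Bool} (hG : Monotone G) {a b : Fin n → Bool}
    (hab : ∀ i, a i = true → b i = true) (ha : G a = true) : G b = true := by
  have hle : a ≤ b := fun i => by
    have := hab i
    cases ha' : a i <;> cases hb' : b i <;> simp_all
  have := hG hle
  rw [ha] at this
  cases hGb : G b
  · rw [hGb] at this; exact absurd this (by decide)
  · rfl

/-- A sum of Boolean indicators is a cardinality. [folklore] -/
theorem sum_toNat_eq_card (b : (Fin n → Bool) → Bool) :
    ∑ x : Fin n → Bool, ((Bool.toNat (b x) : ℕ) : ℤ) = ((Finset.univ.filter (fun x => b x = true)).card : ℤ) := by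
  rw [Finset.natCast_card_filter]
  refine Finset.sum_congr rfl (fun x _ => ?_)
  cases b x <;> simp

/-- The antipode preserves the number of points satisfying a predicate. [folklore] -/
theorem card_filter_antipode (p : (Fin n → Bool) → Prop) [DecidablePred p] :
    (Finset.univ.filter (fun x : Fin n → Bool => p (fun i => !x i))).card = (Finset.univ.filter p).card := by
  rw [← Finset.card_image_of_injective (Finset.univ.filter (fun x : Fin n → Bool => p (fun i => !x i)))
    (flipOn_injective Finset.univ)]
  congr 1
  ext y
  rw [Finset.mem_image, Finset.mem_filter]
  constructor
  · rintro ⟨x, hx, rfl⟩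
    rw [Finset.mem_filter] at hx
    refine ⟨Finset.mem_univ _, ?_⟩
    rw [flipOn_univ_eq]; exact hx.2
  · rintro ⟨_, hy⟩
    refine ⟨flipOn Finset.univ y, ?_, flipOn_flipOn _ y⟩
    rw [Finset.mem_filter]
    refine ⟨Finset.mem_univ _, ?_⟩
    rw [flipOn_univ_eq]
    have : (fun i => !(fun i => !y i) i) = y := by funext i; simp
    rw [this]; exact hy

/-- **THEOREM K (`comb_sum_nonneg`).**  For all monotone Boolean functions `A, B, G` on the cube `Fin n → Bool`, the comb sum
(top tensor-Bernstein coefficient of the master-family inequality)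
`K(A,B,G) = #{x ∈ ABG} − #{x ∈ AG : x̄ ∈ BG} − #{x ∈ G : x̄ ∈ AB ∖ G}` is nonnegative.
Proof: the Kleitman–compression matching (`disjoint_matching` with `S = σG`, `H = G ∩ σG`, full shift) injects the
`L`-points of `A∩B` into `G ∖ Z` (`Z` = antipode of the fully down-shifted `H`), and the antipode of the down-shifted
`N = AG ∩ σ(BG)` lies inside `A ∩ B ∩ Z` (monotonicity of shifts, containment in lower-closed families, σ-invariance). [this work] -/
theorem comb_sum_nonneg (A B G : (Fin n → Bool) → Bool) (hA : Monotone A) (hB : Monotone B) (hG : Monotone G) :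
    0 ≤ ∑ x : Fin n → Bool, (((Bool.toNat (A x && B x && G x) : ℕ) : ℤ)
      - ((Bool.toNat (A x && G x && B (fun i => !x i) && G (fun i => !x i)) : ℕ) : ℤ)
      - ((Bool.toNat (G x && A (fun i => !x i) && B (fun i => !x i) && !(G (fun i => !x i))) : ℕ) : ℤ)) := by
  classical
  -- the families
  set S : Finset (Fin n → Bool) := Finset.univ.filter (fun x => G (fun i => !x i) = true) with hSdef
  set H : Finset (Fin n → Bool) := Finset.univ.filter (fun x => G x = true ∧ G (fun i => !x i) = true) with hHdef
  have hanti : ∀ y z : Fin n → Bool, (∀ i, y i = true → z i = true) → ∀ i, (fun i => !z i) i = true → (fun i => !y i) i = true := by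
    intro y z h i hi
    have := h i
    cases hy : y i <;> cases hz : z i <;> simp_all
  have hS : ∀ z ∈ S, ∀ y : Fin n → Bool, (∀ i, y i = true → z i = true) → y ∈ S := by
    intro z hz y hyz
    rw [hSdef, Finset.mem_filter] at hz ⊢
    exact ⟨Finset.mem_univ _, mono_apply hG (hanti y z hyz) hz.2⟩
  have hHS : H ⊆ S := by
    intro x hx; rw [hHdef, Finset.mem_filter] at hx; rw [hSdef, Finset.mem_filter]; exact ⟨hx.1, hx.2.2⟩
  have hH : ∀ x ∈ H, ∀ y ∈ S, (∀ i, x i = true → y i = true) → y ∈ H := by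
    intro x hx y hy hxy
    rw [hHdef, Finset.mem_filter] at hx ⊢
    rw [hSdef, Finset.mem_filter] at hy
    exact ⟨Finset.mem_univ _, mono_apply hG hxy hx.2.1, hy.2⟩
  set s : List (Fin n) := List.finRange n with hsdef
  have hs : s.Nodup := List.nodup_finRange n
  have hall : ∀ i, i ∈ s := fun i => List.mem_finRange i
  obtain ⟨ψ, hψ⟩ := disjoint_matching S H hS hHS hH s hs
  set Z : Finset (Fin n → Bool) := (dnSeq s H).image (flipOn Finset.univ) with hZdef
  have hKS : dnSeq s H ⊆ S := dnSeq_subset_of_lower s hHS (update_false_mem_of_lower hS)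
  -- the four counts
  set WG : Finset (Fin n → Bool) := Finset.univ.filter (fun x => (A x && B x && G x) = true) with hWG
  set N : Finset (Fin n → Bool) := Finset.univ.filter
    (fun x => (A x && G x && B (fun i => !x i) && G (fun i => !x i)) = true) with hN
  set WL : Finset (Fin n → Bool) := Finset.univ.filter
    (fun y => (G (fun i => !y i) && A y && B y && !(G y)) = true) with hWL
  set WZ : Finset (Fin n → Bool) := Finset.univ.filter (fun x => A x = true ∧ B x = true ∧ x ∈ Z) with hWZ
  have hsum : ∑ x : Fin n → Bool, (((Bool.toNat (A x && B x && G x) : ℕ) : ℤ)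
      - ((Bool.toNat (A x && G x && B (fun i => !x i) && G (fun i => !x i)) : ℕ) : ℤ)
      - ((Bool.toNat (G x && A (fun i => !x i) && B (fun i => !x i) && !(G (fun i => !x i))) : ℕ) : ℤ))
      = (WG.card : ℤ) - (N.card : ℤ) - (WL.card : ℤ) := by
    rw [Finset.sum_sub_distrib, Finset.sum_sub_distrib, sum_toNat_eq_card, sum_toNat_eq_card, sum_toNat_eq_card]
    congr 1
    rw [hWL]
    have hc := card_filter_antipode (fun y : Fin n → Bool => (G (fun i => !y i) && A y && B y && !(G y)) = true)
    simp only [Bool.not_not] at hc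
    exact_mod_cast hc
  rw [hsum]
  -- (♣): WL injects into WG ∖ WZ
  have hWZsub : WZ ⊆ WG := by
    intro x hx
    rw [hWZ, Finset.mem_filter] at hx
    rw [hWG, Finset.mem_filter]
    obtain ⟨_, hAx, hBx, hxZ⟩ := hx
    rw [hZdef, mem_image_flipOn] at hxZ
    have hxS := hKS hxZ
    rw [hSdef, Finset.mem_filter, flipOn_univ_eq] at hxS
    have hGx : G x = true := by
      have := hxS.2; simp only [Bool.not_not] at this; exact this
    exact ⟨Finset.mem_univ _, by simp [hAx, hBx, hGx]⟩
  have hLmem : ∀ y : Fin n → Bool, y ∈ WL → y ∈ S \ H := by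
    intro y hy
    rw [hWL, Finset.mem_filter] at hy
    have h := hy.2
    simp only [Bool.and_eq_true, Bool.not_eq_true'] at h
    rw [Finset.mem_sdiff, hSdef, hHdef, Finset.mem_filter, Finset.mem_filter]
    exact ⟨⟨Finset.mem_univ _, h.1.1.1⟩, fun hh => by rw [hh.2.1] at h; exact absurd h.2 (by decide)⟩
  let f : (Fin n → Bool) → (Fin n → Bool) := fun y =>
    if h : y ∈ WL then (fun i => !(((ψ ⟨y, hLmem y h⟩ : ↥(S \ dnSeq s H)) : Fin n → Bool) i)) else y
  have hfprop : ∀ y (hy : y ∈ WL), f y = (fun i => !(((ψ ⟨y, hLmem y hy⟩ : ↥(S \ dnSeq s H)) : Fin n → Bool) i)) := by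
    intro y hy; simp only [f, dif_pos hy]
  have hle : ∀ y (hy : y ∈ WL), ∀ i, y i = true → f y i = true := by
    intro y hy i hyi
    rw [hfprop y hy]
    have := hψ ⟨y, hLmem y hy⟩ i
    simp only [hyi, true_and] at this
    simpa using this
  have hmaps : ∀ y ∈ WL, f y ∈ WG \ WZ := by
    intro y hy
    have hyL := hy
    rw [hWL, Finset.mem_filter] at hyL
    have h := hyL.2
    simp only [Bool.and_eq_true, Bool.not_eq_true'] at h
    set t : ↥(S \ dnSeq s H) := ψ ⟨y, hLmem y hy⟩ with ht
    have htS : (t : Fin n → Bool) ∈ Finset.univ.filter (fun x : Fin n → Bool => G (fun i => !x i) = true) :=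
      (Finset.mem_sdiff.mp t.2).1
    have htK : (t : Fin n → Bool) ∉ dnSeq s H := (Finset.mem_sdiff.mp t.2).2
    rw [Finset.mem_filter] at htS
    have hfy : f y = fun i => !((t : Fin n → Bool) i) := hfprop y hy
    rw [Finset.mem_sdiff, hWG, hWZ, Finset.mem_filter, Finset.mem_filter]
    refine ⟨⟨Finset.mem_univ _, ?_⟩, ?_⟩
    · have hAf : A (f y) = true := mono_apply hA (hle y hy) h.1.1.2
      have hBf : B (f y) = true := mono_apply hB (hle y hy) h.1.2
      have hGf : G (f y) = true := by rw [hfy]; exact htS.2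
      simp [hAf, hBf, hGf]
    · rintro ⟨_, _, _, hfZ⟩
      rw [hZdef, mem_image_flipOn, flipOn_univ_eq, hfy] at hfZ
      apply htK
      have : (fun i => !(fun i => !((t : Fin n → Bool) i)) i) = (t : Fin n → Bool) := by funext i; simp
      rw [this] at hfZ; exact hfZ
  have hinj : Set.InjOn f ↑WL := by
    intro y hy y' hy' hff
    have hy2 : y ∈ WL := hy
    have hy2' : y' ∈ WL := hy'
    rw [hfprop y hy2, hfprop y' hy2'] at hff
    have h3 : (((ψ ⟨y, hLmem y hy2⟩ : ↥(S \ dnSeq s H)) : Fin n → Bool)) =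
        (((ψ ⟨y', hLmem y' hy2'⟩ : ↥(S \ dnSeq s H)) : Fin n → Bool)) := by
      funext i; have := congrFun hff i; simpa using this
    have h4 := ψ.injective (Subtype.ext h3)
    exact congrArg Subtype.val h4
  have hcard1 : WL.card ≤ (WG \ WZ).card := Finset.card_le_card_of_injOn f hmaps hinj
  have hcard2 : (WG \ WZ).card + WZ.card = WG.card := Finset.card_sdiff_add_card_eq_card hWZsub
  -- (♦♦): N injects into WZ via the antipode of the down-shift
  set N' : Finset (Fin n → Bool) := N.image (flipOn Finset.univ) with hN'
  have hNN' : N = N'.image (flipOn Finset.univ) := by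
    rw [hN', Finset.image_image]
    have : (flipOn Finset.univ ∘ flipOn Finset.univ : (Fin n → Bool) → (Fin n → Bool)) = id := by
      funext x; exact flipOn_flipOn _ x
    rw [this, Finset.image_id]
  have hNH : N ⊆ H := by
    intro x hx
    rw [hN, Finset.mem_filter] at hx
    have h := hx.2; simp only [Bool.and_eq_true] at h
    rw [hHdef, Finset.mem_filter]
    exact ⟨Finset.mem_univ _, h.1.1.2, h.2⟩
  set SA : Finset (Fin n → Bool) := Finset.univ.filter (fun y => A (fun i => !y i) = true) with hSA
  set SB : Finset (Fin n → Bool) := Finset.univ.filter (fun y => B (fun i => !y i) = true) with hSB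
  have hSA_low : ∀ x ∈ SA, ∀ j, Function.update x j false ∈ SA := by
    refine update_false_mem_of_lower (fun z hz y hyz => ?_)
    rw [hSA, Finset.mem_filter] at hz ⊢
    exact ⟨Finset.mem_univ _, mono_apply hA (hanti y z hyz) hz.2⟩
  have hSB_low : ∀ x ∈ SB, ∀ j, Function.update x j false ∈ SB := by
    refine update_false_mem_of_lower (fun z hz y hyz => ?_)
    rw [hSB, Finset.mem_filter] at hz ⊢
    exact ⟨Finset.mem_univ _, mono_apply hB (hanti y z hyz) hz.2⟩
  have hN'A : N' ⊆ SA := by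
    intro y hy
    rw [hN', mem_image_flipOn, hN, Finset.mem_filter, flipOn_univ_eq] at hy
    have h := hy.2; simp only [Bool.and_eq_true] at h
    rw [hSA, Finset.mem_filter]
    exact ⟨Finset.mem_univ _, h.1.1.1⟩
  have hNB : N ⊆ SB := by
    intro x hx
    rw [hN, Finset.mem_filter] at hx
    have h := hx.2; simp only [Bool.and_eq_true] at h
    rw [hSB, Finset.mem_filter]
    exact ⟨Finset.mem_univ _, h.1.2⟩
  have hDA : dnSeq s N ⊆ SA := by
    rw [hNN', dnSeq_image_antipode s hall]
    exact dnSeq_subset_of_lower s hN'A hSA_low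
  have hDB : dnSeq s N ⊆ SB := dnSeq_subset_of_lower s hNB hSB_low
  have hDH : dnSeq s N ⊆ dnSeq s H := dnSeq_mono s hNH
  have hMsub : (dnSeq s N).image (flipOn Finset.univ) ⊆ WZ := by
    intro z hz
    rw [mem_image_flipOn] at hz
    rw [hWZ, Finset.mem_filter]
    have hzA := hDA hz
    have hzB := hDB hz
    rw [hSA, Finset.mem_filter, flipOn_univ_eq] at hzA
    rw [hSB, Finset.mem_filter, flipOn_univ_eq] at hzB
    have hnn : (fun i => !(fun i => !z i) i) = z := by funext i; simp
    rw [hnn] at hzA hzB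
    refine ⟨Finset.mem_univ _, hzA.2, hzB.2, ?_⟩
    rw [hZdef, mem_image_flipOn]
    exact hDH hz
  have hcard3 : N.card ≤ WZ.card := by
    have := Finset.card_le_card hMsub
    rwa [Finset.card_image_of_injective _ (flipOn_injective _), card_dnSeq] at this
  -- conclude
  have h1 : (WL.card : ℤ) ≤ ((WG \ WZ).card : ℤ) := by exact_mod_cast hcard1
  have h2 : (((WG \ WZ).card : ℤ)) + (WZ.card : ℤ) = (WG.card : ℤ) := by exact_mod_cast hcard2
  have h3 : (N.card : ℤ) ≤ (WZ.card : ℤ) := by exact_mod_cast hcard3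
  linarith


/-! ### 11. `F ≥ 0` for every monotone third event -/

/-- **THEOREM F (`F_nonneg_of_monotone`).**  For every `n`, every `p ∈ [0,1]^n` and all MONOTONE Boolean functions
`A, B, G` on `Fin n → Bool`:  `(1 + μ_pG)·μ_p(A∩B∩G) − μ_pG·μ_p(A∩B) − μ_p(A∩G)·μ_p(B∩G) ≥ 0`.
(Face expansion `F_nonneg_of_face_combs_nonneg` + `face_comb_sum_eq` + `comb_sum_nonneg` on every face.) [this work] -/
theorem F_nonneg_of_monotone (p : Fin n → ℝ) (hp0 : ∀ i, 0 ≤ p i) (hp1 : ∀ i, p i ≤ 1)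
    (A B G : (Fin n → Bool) → Bool) (hA : Monotone A) (hB : Monotone B) (hG : Monotone G) :
    0 ≤ (1 + ∑ s : Fin n → Bool, (∏ i, (if s i then p i else 1 - p i)) * (Bool.toNat (G s) : ℝ))
        * (∑ s : Fin n → Bool, (∏ i, (if s i then p i else 1 - p i)) * (Bool.toNat (A s && B s && G s) : ℝ))
      - (∑ s : Fin n → Bool, (∏ i, (if s i then p i else 1 - p i)) * (Bool.toNat (G s) : ℝ))
        * (∑ s : Fin n → Bool, (∏ i, (if s i then p i else 1 - p i)) * (Bool.toNat (A s && B s) : ℝ))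
      - (∑ s : Fin n → Bool, (∏ i, (if s i then p i else 1 - p i)) * (Bool.toNat (A s && G s) : ℝ))
        * (∑ s : Fin n → Bool, (∏ i, (if s i then p i else 1 - p i)) * (Bool.toNat (B s && G s) : ℝ)) := by
  refine F_nonneg_of_face_combs_nonneg p hp0 hp1 A B G (fun d z => ?_)
  by_cases hz : ∀ i, d i = true → z i = false
  · obtain ⟨e⟩ : Nonempty (Fin (Fintype.card {i : Fin n // d i = true}) ≃ {i : Fin n // d i = true}) :=
      ⟨(Fintype.equivFin _).symm⟩
    rw [face_comb_sum_eq A B G d z e hz]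
    have hA' : Monotone (fun y : Fin (Fintype.card {i : Fin n // d i = true}) → Bool =>
        A (fun i => if h : d i = true then y (e.symm ⟨i, h⟩) else z i)) :=
      fun y y' hy => hA (emb_mono d z e hy)
    have hB' : Monotone (fun y : Fin (Fintype.card {i : Fin n // d i = true}) → Bool =>
        B (fun i => if h : d i = true then y (e.symm ⟨i, h⟩) else z i)) :=
      fun y y' hy => hB (emb_mono d z e hy)
    have hG' : Monotone (fun y : Fin (Fintype.card {i : Fin n // d i = true}) → Bool =>
        G (fun i => if h : d i = true then y (e.symm ⟨i, h⟩) else z i)) :=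
      fun y y' hy => hG (emb_mono d z e hy)
    have key := comb_sum_nonneg _ _ _ hA' hB' hG'
    exact_mod_cast key
  · rw [← Finset.sum_filter, fiber_eq_empty d z hz, Finset.sum_empty]

end SahiFComb

end Summit.CriticalPhenomena.PercolationContinuityZ3.Theorems
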